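import Summits.QuantumAdvantage.QuantumAdvantage.Theorems.ScaleDialC

/-!
# ScaleDial, part D/4: the OCTIC RUNG `OctLoss3` (`2^(n^{1/8})` odd losses), the finer cut
`massStep3u_iff_three : MassStep3u ↔ (MesoLo3 ∧ MesoHi3 ∧ TopLift3)` and its ATTACK EDGE
`octLoss3_of_noPerfectSqrt3 : NoPerfectSqrt3 → OctLoss3` (absorption with `k = n^{1/8}` tokens at degree `√n`) —
support for item 26533

Cell decomp-qadv, seat lens-1 («grading / quantitative ladder»), generation 12 — land port of §D of the node «ScaleDial»
rev 2 (published under the cell's HOME/decomp-qadv-lens-1/g12/ScaleDial.lean, record NODE-g12.md; RESIDUAL MODE on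
ExactnessDial:26533 `MassStep3u := NoPerfectOdd3 → PolyLossOddU3`).  Prop-defs = the node's rungs / pieces only
(`OctLoss3`, `NoPerfectSqrt3`, `MesoLo3`, `MesoHi3`; data def `oct`).  No `sorry`, no new axioms, no instances, no notation.
-/

set_option linter.dupNamespace false
set_option linter.style.longLine false

noncomputable section

open scoped Classical

namespace Summit.QuantumAdvantage.QuantumAdvantage.Theorems.ScaleDial

open Finset
open Literature.Computability.QuantumComplexity Literature.Computability.QuantumComplexity.RingHLF
open Literature.Computability.MetaComplexity Literature.Computability.MetaComplexity.Smolensky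
open Summit.QuantumAdvantage.AdviceFreeQNC0
open Summit.QuantumAdvantage.QuantumAdvantage.Theorems.RingPeriodFold (cov covStrat covStrat_mem_lowDeg)
open Summit.QuantumAdvantage.QuantumAdvantage.Theses.ExactnessDial (NoPerfectOdd3 PolyLossOddU3 MassStep3u OddToAll3
  DPLift3 MultiRingBridge3 NoPerfectConst3)

/-! ## D. A finer cut BENEATH the residual, with an ATTACK EDGE: the octic rung `2^(n^{1/8})`, bought from exactness
at degree `√n` by the same exchange rate (`NoPerfectSqrt3 ⟹ OctLoss3`)

The mesoscopic range `[2^polylog, 2^(n − polylog)]` left open by F1/F2 is cut once more, at `2^(oct n)` (`oct n = n^{1/8}`,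
three integer square roots).  The bottom half `MesoLo3 := QML3 → OctLoss3` is then ATTACKABLE through an EDGE that is
NOT implied by `T`: `NoPerfectSqrt3` (no PERFECT strategy of `𝔽₃`-degree `⌊√n⌋` on the odd class, eventually — exactness
one notch up the DEGREE axis, where Smolensky-type arguments still operate) buys `2^(n^{1/8})` losses at every polylog
degree by ABSORPTION with `k = n^{1/8}` tokens (`octLoss3_of_noPerfectSqrt3`).  The top half `MesoHi3 := OctLoss3 →
QFracU3` carries what is left of the mass content and stays the declared residual. -/

section Edge

/-- `n^{1/8}` in ℕ: three integer square roots. -/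
def oct (n : ℕ) : ℕ := Nat.sqrt (Nat.sqrt (Nat.sqrt n))

/-- ScaleDialD helper `oct_le_sqrt` (decomp-qadv land package; see the module docstring). -/
theorem oct_le_sqrt (n : ℕ) : oct n ≤ Nat.sqrt n := (Nat.sqrt_le_self _).trans (Nat.sqrt_le_self _)

/-- ScaleDialD helper `le_oct_of_pow_le` (decomp-qadv land package; see the module docstring). -/
theorem le_oct_of_pow_le {x n : ℕ} (h : x ^ 8 ≤ n) : x ≤ oct n := by
  have h4 : x ^ 4 ≤ Nat.sqrt n := Nat.le_sqrt.2 (by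
    calc x ^ 4 * x ^ 4 = x ^ 8 := by ring
      _ ≤ n := h)
  have h2 : x ^ 2 ≤ Nat.sqrt (Nat.sqrt n) := Nat.le_sqrt.2 (by
    calc x ^ 2 * x ^ 2 = x ^ 4 := by ring
      _ ≤ Nat.sqrt n := h4)
  exact Nat.le_sqrt.2 (by
    calc x * x = x ^ 2 := by ring
      _ ≤ Nat.sqrt (Nat.sqrt n) := h2)

/-- ScaleDialD helper `one_le_oct` (decomp-qadv land package; see the module docstring). -/
theorem one_le_oct {n : ℕ} (hn : 1 ≤ n) : 1 ≤ oct n := le_oct_of_pow_le (by simpa using hn)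

/-- `(log₂ n)^A ≤ oct n` once `n ≥ 2^(2^(8A+1))`. -/
theorem logpow_le_oct {A n : ℕ} (hn : 2 ^ (2 ^ (8 * A + 1)) ≤ n) : (Nat.log 2 n) ^ A ≤ oct n := by
  set L := Nat.log 2 n with hL
  have hn0 : n ≠ 0 := by have := Nat.one_le_two_pow (n := 2 ^ (8 * A + 1)); omega
  have hLbig : 2 ^ (8 * A + 1) ≤ L := Nat.le_log_of_pow_le (by norm_num) hn
  have hLn : 2 ^ L ≤ n := Nat.pow_log_le_self 2 hn0
  have h1 : L ^ (8 * A) < 2 ^ L := pow_lt_two_pow hLbig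
  apply le_oct_of_pow_le
  calc (L ^ A) ^ 8 = L ^ (8 * A) := by rw [← pow_mul, Nat.mul_comm]
    _ ≤ n := by omega

/-- **OctLoss3 — the octic rung**: every polylog-degree strategy loses at least `2^(n^{1/8})` odd patterns, eventually.
[T-implied (`octLoss3_of_polyLossOddU3`); strictly inside the mesoscopic range: `QFracU3 ⟹ OctLoss3 ⟹ QML3`.] -/
def OctLoss3 : Prop :=
  ∀ c : ℕ, ∃ n₀ : ℕ, ∀ n ≥ n₀, ∀ P : Fin n → CubeFn (ZMod 3) n,
    (∀ i, P i ∈ lowDeg (ZMod 3) n ((Nat.log 2 n) ^ c)) → 2 ^ (oct n) ≤ (losers n P).card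

/-- **NoPerfectSqrt3 — the ATTACK EDGE** [NOT T-implied (T-currency is polylog degree) · UNDECIDED · sits ABOVE 26532
on the degree axis (`noPerfectOdd3_of_noPerfectSqrt3`) · an EDGE, never a piece]: no strategy of `𝔽₃`-degree `⌊√n⌋` is
perfect on the odd class of `C_n`, eventually. -/
def NoPerfectSqrt3 : Prop := ∃ n₀ : ℕ, ∀ n ≥ n₀, ¬ PerfectAt n (Nat.sqrt n)

/-- the bottom half of the mesoscopic lift [T-implied · ATTACKABLE via the edge: `mesoLo3_of_noPerfectSqrt3`]. -/
def MesoLo3 : Prop := QML3 → OctLoss3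

/-- the top half of the mesoscopic lift [M · declared RESIDUAL of this finer cut · T-implied · UNDECIDED · IDEA-NEEDED]. -/
def MesoHi3 : Prop := OctLoss3 → QFracU3

/-- `OctLoss3 → QML3` (down: `2^((log₂ n)^A) ≤ 2^(n^{1/8})` eventually). -/
theorem qml3_of_octLoss3 (h : OctLoss3) : QML3 := by
  intro A c
  obtain ⟨n₀, hn₀⟩ := h c
  refine ⟨max n₀ (2 ^ (2 ^ (8 * A + 1))), fun n hn P hP => ?_⟩
  have h1 := hn₀ n (le_trans (le_max_left _ _) hn) P hP
  have hA : (Nat.log 2 n) ^ A ≤ oct n := logpow_le_oct (le_trans (le_max_right _ _) hn)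
  exact le_trans (Nat.pow_le_pow_right (by norm_num) hA) h1

/-- `QFracU3 → OctLoss3` (down: a `2^{−(log₂ n)^B}` fraction of `2^(n−1)` exceeds `2^(n^{1/8})`). -/
theorem octLoss3_of_qFracU3 (h : QFracU3) : OctLoss3 := by
  obtain ⟨B, hB⟩ := h
  intro c
  obtain ⟨n₀, hn₀⟩ := hB c
  refine ⟨max n₀ (2 ^ (2 ^ (B + B + 2)) + 16), fun n hn P hP => ?_⟩
  have h1 := hn₀ n (le_trans (le_max_left _ _) hn) P hP
  have hmax : 2 ^ (2 ^ (B + B + 2)) + 16 ≤ n := le_trans (le_max_right _ _) hn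
  have hb0 : 1 ≤ 2 ^ (2 ^ (B + B + 2)) := Nat.one_le_two_pow
  have hnbig : 2 ^ (2 ^ (B + B + 2)) ≤ n := by omega
  have hn16 : 16 ≤ n := by omega
  have hn1 : 1 ≤ n := by omega
  set L := Nat.log 2 n with hL
  have hsum' : L ^ B + L ^ B ≤ n - 1 := logpow_add_logpow_le hnbig
  have hs4 : 4 ≤ Nat.sqrt n := Nat.le_sqrt.2 (by omega)
  have hss : Nat.sqrt n * Nat.sqrt n ≤ n := Nat.sqrt_le n
  have hsq : 4 * Nat.sqrt n ≤ n := le_trans (Nat.mul_le_mul_right (Nat.sqrt n) hs4) hss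
  have hos : oct n ≤ Nat.sqrt n := oct_le_sqrt n
  have hsum : oct n + L ^ B ≤ n - 1 := by omega
  have hw := winners_card_eq hn1 P
  have hl := losers_card_le hn1 P
  have hwR : ((winners n P).card : ℝ) = (2 : ℝ) ^ (n - 1) - (losers n P).card := by
    rw [hw, Nat.cast_sub hl]; push_cast; ring
  rw [hwR] at h1
  have h2pos : (0 : ℝ) < (2 : ℝ) ^ (L ^ B) := pow_pos (by norm_num) _
  have h2 : (2 : ℝ) ^ (n - 1) / (2 : ℝ) ^ (L ^ B) ≤ (losers n P).card := by
    have : (2 : ℝ) ^ (n - 1) / (2 : ℝ) ^ (L ^ B) = (1 / (2 : ℝ) ^ (L ^ B)) * (2 : ℝ) ^ (n - 1) := by ring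
    rw [this]; nlinarith
  have h3 : (2 : ℝ) ^ (oct n) ≤ (2 : ℝ) ^ (n - 1) / (2 : ℝ) ^ (L ^ B) := by
    rw [le_div_iff₀ h2pos, ← pow_add]
    exact pow_le_pow_right₀ (by norm_num) hsum
  exact_mod_cast h3.trans h2

/-- `PolyLossOddU3 → OctLoss3`: the octic rung is `T`-implied. -/
theorem octLoss3_of_polyLossOddU3 (h : PolyLossOddU3) : OctLoss3 := octLoss3_of_qFracU3 (qFracU3_of_polyLossOddU3 h)

/-- the edge sits above 26532 on the degree axis: `NoPerfectSqrt3 → NoPerfectOdd3` (`(log₂ n)^c ≤ √n` eventually). -/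
theorem noPerfectOdd3_of_noPerfectSqrt3 (h : NoPerfectSqrt3) : NoPerfectOdd3 := by
  obtain ⟨n₀, hn₀⟩ := h
  rw [noPerfectOdd3_iff_cells]
  intro c
  refine ⟨max n₀ (2 ^ (2 ^ (2 * c + 1))), fun n hn hperf => ?_⟩
  have hn₀' : n₀ ≤ n := le_trans (le_max_left _ _) hn
  have hnbig : 2 ^ (2 ^ (2 * c + 1)) ≤ n := le_trans (le_max_right _ _) hn
  set L := Nat.log 2 n with hL
  have hn0 : n ≠ 0 := by have := Nat.one_le_two_pow (n := 2 ^ (2 * c + 1)); omega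
  have hLbig : 2 ^ (2 * c + 1) ≤ L := Nat.le_log_of_pow_le (by norm_num) hnbig
  have hLn : 2 ^ L ≤ n := Nat.pow_log_le_self 2 hn0
  have h1 : L ^ (2 * c) < 2 ^ L := pow_lt_two_pow hLbig
  have hdeg : L ^ c ≤ Nat.sqrt n := Nat.le_sqrt.2 (by
    calc L ^ c * L ^ c = L ^ (2 * c) := by ring
      _ ≤ n := by omega)
  exact hn₀ n hn₀' (perfectAt_mono hdeg hperf)

/-- ★ **THE EDGE BUYS THE OCTIC RUNG: `NoPerfectSqrt3 → OctLoss3`.**  Absorption with `k = n^{1/8}` tokens: a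
polylog-degree strategy on `C_n` with fewer than `2^k` odd losses yields a PERFECT strategy on `C_{n−3k}` of degree
`(3k+1)²(2(log₂ n)^c+1) ≤ 48·n^{1/4}·(log₂ n)^c ≤ √(n − 3k)`. -/
theorem octLoss3_of_noPerfectSqrt3 (h : NoPerfectSqrt3) : OctLoss3 := by
  obtain ⟨n₀, hn₀⟩ := h
  intro c
  refine ⟨2 * n₀ + 2 ^ (2 ^ (4 * c + 26)), fun n hn P hP => ?_⟩
  by_contra hlt
  rw [not_le] at hlt
  set L := Nat.log 2 n with hL
  have hnbig : 2 ^ (2 ^ (4 * c + 26)) ≤ n := le_trans (Nat.le_add_left _ _) hn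
  have hn0 : n ≠ 0 := by have := Nat.one_le_two_pow (n := 2 ^ (4 * c + 26)); omega
  have hLbig : 2 ^ (4 * c + 26) ≤ L := Nat.le_log_of_pow_le (by norm_num) hnbig
  have hL2 : 2 ≤ L := le_trans (by
    calc 2 = 2 ^ 1 := rfl
      _ ≤ 2 ^ (4 * c + 26) := Nat.pow_le_pow_right (by norm_num) (by omega)) hLbig
  have hLn : 2 ^ L ≤ n := Nat.pow_log_le_self 2 hn0
  have hpl : L ^ (4 * c + 25) < 2 ^ L := pow_lt_two_pow (by simpa [add_assoc] using hLbig)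
  have hbig : 2 ^ 25 * L ^ (4 * c) ≤ n := by
    calc 2 ^ 25 * L ^ (4 * c) ≤ L ^ 25 * L ^ (4 * c) := Nat.mul_le_mul_right _ (Nat.pow_le_pow_left hL2 25)
      _ = L ^ (4 * c + 25) := by ring
      _ ≤ n := by omega
  -- integer square roots (plain variables, for `omega`): `s = √n`, `s₂ = n^{1/4}`, `k = oct n = n^{1/8}`
  obtain ⟨s, hs⟩ : ∃ s, s = Nat.sqrt n := ⟨_, rfl⟩
  obtain ⟨s₂, hs₂⟩ : ∃ s₂, s₂ = Nat.sqrt s := ⟨_, rfl⟩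
  obtain ⟨k, hk⟩ : ∃ k, k = oct n := ⟨_, rfl⟩
  have hks : k = Nat.sqrt s₂ := by rw [hk, oct, ← hs, ← hs₂]
  have hss : s * s ≤ n := by rw [hs]; exact Nat.sqrt_le n
  have hs₂s : s₂ * s₂ ≤ s := by rw [hs₂]; exact Nat.sqrt_le s
  have hkk : k * k ≤ s₂ := by rw [hks]; exact Nat.sqrt_le s₂
  have hk1 : 1 ≤ k := by rw [hk]; exact one_le_oct (by omega)
  have hd1 : 1 ≤ L ^ c := Nat.one_le_pow _ _ (by omega)
  have hd0 : 1 ≤ 2 ^ (2 ^ (4 * c + 26)) := Nat.one_le_two_pow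
  have hlt' : (losers n P).card < 2 ^ k := by rw [hk]; exact hlt
  -- `4608·(log₂ n)^(2c) ≤ √n`
  have hW : 4608 * L ^ (2 * c) ≤ s := by
    rw [hs]
    exact Nat.le_sqrt.2 (by
      calc 4608 * L ^ (2 * c) * (4608 * L ^ (2 * c)) = 21233664 * L ^ (4 * c) := by ring
        _ ≤ 2 ^ 25 * L ^ (4 * c) := Nat.mul_le_mul_right _ (by norm_num)
        _ ≤ n := hbig)
  have hd2 : 1 ≤ L ^ (2 * c) := Nat.one_le_pow _ _ (by omega)
  have hs6 : 6 ≤ s := le_trans (by omega) hW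
  have h6s : 6 * s ≤ n := le_trans (Nat.mul_le_mul_right _ hs6) hss
  have hks₂ : k ≤ s₂ := (Nat.le_mul_self k).trans hkk
  have hs₂le : s₂ ≤ s := (Nat.le_mul_self s₂).trans hs₂s
  have h6k : 6 * k ≤ n := by
    have : k ≤ s := hks₂.trans hs₂le
    omega
  -- the body `n = m + 3k + 1`, `m ≥ 2`, `2(m+1) ≥ n`
  obtain ⟨m, hm, hnm⟩ : ∃ m, 2 ≤ m ∧ n = m + 3 * k + 1 := ⟨n - 3 * k - 1, by omega, by omega⟩
  have hperf := absorb hnm hm P hP hlt'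
  have hm1 : n₀ ≤ m + 1 := by omega
  -- degree: `X = (3k+1)²(2L^c+1) ≤ 48·s₂·L^c`, `X² ≤ 2304·s·L^(2c) ≤ n/2 ≤ m+1`
  have hX1 : (3 * k + 1) ^ 2 * (2 * L ^ c + 1) ≤ 48 * s₂ * L ^ c := by
    have hk2 : (3 * k + 1) ^ 2 ≤ 16 * (k * k) := by
      have hsq : (3 * k + 1) ^ 2 = 9 * (k * k) + 6 * k + 1 := by ring
      have hkk1 : k ≤ k * k := Nat.le_mul_self k
      omega
    calc (3 * k + 1) ^ 2 * (2 * L ^ c + 1) ≤ 16 * (k * k) * (3 * L ^ c) := Nat.mul_le_mul hk2 (by omega)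
      _ ≤ 16 * s₂ * (3 * L ^ c) := Nat.mul_le_mul_right _ (Nat.mul_le_mul_left _ hkk)
      _ = 48 * s₂ * L ^ c := by ring
  have hA : 4608 * L ^ (2 * c) * s ≤ n := le_trans (Nat.mul_le_mul_right _ hW) hss
  obtain ⟨Z, hZ⟩ : ∃ Z, Z = 2304 * s * L ^ (2 * c) := ⟨_, rfl⟩
  have hZ2 : 2 * Z ≤ n := by
    rw [hZ]
    calc 2 * (2304 * s * L ^ (2 * c)) = 4608 * L ^ (2 * c) * s := by ring
      _ ≤ n := hA
  have hXX : (3 * k + 1) ^ 2 * (2 * L ^ c + 1) * ((3 * k + 1) ^ 2 * (2 * L ^ c + 1)) ≤ m + 1 := by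
    calc (3 * k + 1) ^ 2 * (2 * L ^ c + 1) * ((3 * k + 1) ^ 2 * (2 * L ^ c + 1))
        ≤ (48 * s₂ * L ^ c) * (48 * s₂ * L ^ c) := Nat.mul_le_mul hX1 hX1
      _ = 2304 * (s₂ * s₂) * L ^ (2 * c) := by ring
      _ ≤ 2304 * s * L ^ (2 * c) := Nat.mul_le_mul_right _ (Nat.mul_le_mul_left _ hs₂s)
      _ = Z := hZ.symm
      _ ≤ m + 1 := by omega
  have hdeg : (3 * k + 1) ^ 2 * (2 * L ^ c + 1) ≤ Nat.sqrt (m + 1) := Nat.le_sqrt.2 hXX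
  exact hn₀ (m + 1) hm1 (perfectAt_mono hdeg hperf)

/-- the edge closes the bottom half of the mesoscopic lift outright. -/
theorem mesoLo3_of_noPerfectSqrt3 (h : NoPerfectSqrt3) : MesoLo3 := fun _ => octLoss3_of_noPerfectSqrt3 h

/-- the mesoscopic lift cut at the octic rung (exact: both halves are lifts along the same ladder). -/
theorem mesoLift3_iff_oct : MesoLift3 ↔ (MesoLo3 ∧ MesoHi3) :=
  ⟨fun h => ⟨fun hq => octLoss3_of_qFracU3 (h hq), fun ho => h (qml3_of_octLoss3 ho)⟩,
    fun ⟨hlo, hhi⟩ hq => hhi (hlo hq)⟩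

/-- ★ **THE THREE-PIECE SCALE SPLIT OF 26533**: `MassStep3u ⟺ MesoLo3 ∧ MesoHi3 ∧ TopLift3` — cuts at `2^(n^{1/8})`
(attack edge `NoPerfectSqrt3` below it) and at the covariance scale `2^(−polylog)·2^(n−1)` (symmetrisation above it). -/
theorem massStep3u_iff_three : MassStep3u ↔ (MesoLo3 ∧ MesoHi3 ∧ TopLift3) := by
  rw [massStep3u_iff_pieces, mesoLift3_iff_oct, and_assoc]

/-- the junction 26531 four ways. -/
theorem polyLossOddU3_iff_four : PolyLossOddU3 ↔ (NoPerfectOdd3 ∧ MesoLo3 ∧ MesoHi3 ∧ TopLift3) := by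
  rw [polyLossOddU3_iff_pieces, mesoLift3_iff_oct, and_assoc]

/-- necessity: all three pieces and the octic rung are consequences of the junction 26531. -/
theorem three_of_polyLossOddU3 (h : PolyLossOddU3) : MesoLo3 ∧ MesoHi3 ∧ TopLift3 := (polyLossOddU3_iff_four.1 h).2

/-- **the EDGE assembly**: `NoPerfectSqrt3 ∧ MesoHi3 ∧ TopLift3 ⟹ PolyLossOddU3` — exactness at degree `√n`, the top half
of the mesoscopic lift and the density upgrade give the junction (26532 and `MesoLo3` are then theorems). -/
theorem polyLossOddU3_of_edge (hS : NoPerfectSqrt3) (hHi : MesoHi3) (hB : TopLift3) : PolyLossOddU3 :=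
  hB (hHi (octLoss3_of_noPerfectSqrt3 hS))

/-- ScaleDialD helper `massStep3u_of_edge` (decomp-qadv land package; see the module docstring). -/
theorem massStep3u_of_edge (hS : NoPerfectSqrt3) (hHi : MesoHi3) (hB : TopLift3) : MassStep3u :=
  fun _ => polyLossOddU3_of_edge hS hHi hB

/-- `closes` in the three-piece reading (rung leaf BY NAME). -/
theorem closes₄ (hN : NoPerfectOdd3) (hLo : MesoLo3) (hHi : MesoHi3) (hB : TopLift3) (hO : OddToAll3) (hD : DPLift3) :
    Summit.QuantumAdvantage.AdviceFreeQNC0.AdviceFreeQNC0Three :=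
  closes hN (mesoLift3_iff_oct.2 ⟨hLo, hHi⟩) hB hO hD

/-- `closes` through the EDGE: `NoPerfectSqrt3`, `MesoHi3`, `TopLift3` (+ the route's 26534, 26124) give the rung leaf. -/
theorem closes_edge (hS : NoPerfectSqrt3) (hHi : MesoHi3) (hB : TopLift3) (hO : OddToAll3) (hD : DPLift3) :
    Summit.QuantumAdvantage.AdviceFreeQNC0.AdviceFreeQNC0Three :=
  closes (noPerfectOdd3_of_noPerfectSqrt3 hS) (mesoLift3_iff_oct.2 ⟨mesoLo3_of_noPerfectSqrt3 hS, hHi⟩) hB hO hD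

end Edge

/-! ## Axiom guards -/

/-- info: 'Summit.QuantumAdvantage.QuantumAdvantage.Theorems.ScaleDial.octLoss3_of_noPerfectSqrt3' depends on axioms: [propext, Classical.choice, Quot.sound] -/
#guard_msgs (whitespace := lax) in #print axioms octLoss3_of_noPerfectSqrt3

/-- info: 'Summit.QuantumAdvantage.QuantumAdvantage.Theorems.ScaleDial.massStep3u_iff_three' depends on axioms: [propext, Classical.choice, Quot.sound] -/
#guard_msgs (whitespace := lax) in #print axioms massStep3u_iff_three

/-- info: 'Summit.QuantumAdvantage.QuantumAdvantage.Theorems.ScaleDial.closes_edge' depends on axioms: [propext, Classical.choice, Quot.sound] -/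
#guard_msgs (whitespace := lax) in #print axioms closes_edge

end Summit.QuantumAdvantage.QuantumAdvantage.Theorems.ScaleDial
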